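import Summits.BirchSwinnertonDyer.BirchSwinnertonDyer.Theorems.SchneiderFreeAdditiveX3PoitouTateMiddleExactTrivialCoefficients
import Literature.NumberTheory.GaloisRepresentations.LocalDualityDescent
import Literature.NumberTheory.EllipticCurves.KummerSequenceConnecting
import HarnessLib

/-!
# Dévissage of Milne I Thm. 4.10(b) — the dual short exact sequence and the local orthogonality
# `(ker H¹(f))^⊥ = im H¹(f^D)`

For a short exact sequence `0 → M₁ →(f) M₂ →(g) M₃ → 0` of finite discrete `Γ_K`-modules killed by
`n` over a number field `K`:

* `isSES_tateDual` — **the Cartier duals form a short exact sequence `0 → M₃^D →(g^D) M₂^D →(f^D) M₁^D → 0`**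
  for any intertwining maps `g^D`, `f^D` computing precomposition (`(g^D φ)(m) = φ(g m)`); exactness on
  the right = `ℤ/n`-valued characters of a subgroup of a finite `n`-torsion group extend
  (`restrictHom_surjective`, read through `μₙ(K̄) ≃ ℤ/n`);
* `exists_map_tateDual_eq_of_forall_ker` — at every place `v`, for a family of local invariant maps
  perfect at the finite places and injective at the real ones: **a local class `y ∈ H¹(K_v, M₁^D)`
  annihilating `ker (H¹(K_v, M₁) → H¹(K_v, M₂))` is of the form `H¹(f^D) Y`** — the adjoint pair
  `(H¹(f), H¹(f^D))` under the two perfect local Tate pairings has `{}^⊥(im H¹(f^D)) = ker H¹(f)`, and the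
  double annihilator (Milne I Prop. 0.19) gives `(ker H¹(f))^⊥ = im H¹(f^D)`.

Used by the dévissage of the Poitou–Tate middle exactness (`KolyvaginRoadThreePTDevissage*`).
Theorems only; no case of BSD.

References: [MilneADT2006] I Prop. 0.19, Cor. 2.3, §4; [NeukirchSchmidtWingberg2008] (1.4.2).
-/

noncomputable section

open CategoryTheory Function NumberField IsDedekindDomain
open scoped NumberField ContRepresentation

universe u

set_option linter.dupNamespace false
set_option autoImplicit false

namespace Summit.BirchSwinnertonDyer.BirchSwinnertonDyer.Theorems.KolyvaginRoadThreePT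

open Field
open Literature.NumberTheory.GaloisRepresentations Literature.NumberTheory.GaloisCohomology
open Literature.NumberTheory.GaloisRepresentations.DiscreteGaloisModule (mu MuCarrier TateDual tateDual
  localTatePairingZMod homOfIntertwining)
open Summit.BirchSwinnertonDyer.Rank1Residual.X11b.FiniteDuality
open Summit.BirchSwinnertonDyer.BirchSwinnertonDyer.Theorems.SchneiderFreeAdditiveX3.PoitouTateReduction

/-! ## §1. The dual short exact sequence -/

section DualSES

variable {K : Type u} [Field K] [CharZero K] {n : ℕ} [NeZero n]
variable {M₁ M₂ M₃ : Type u}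
  [AddCommGroup M₁] [TopologicalSpace M₁] [DiscreteTopology M₁] [Finite M₁]
  [AddCommGroup M₂] [TopologicalSpace M₂] [DiscreteTopology M₂] [Finite M₂]
  [AddCommGroup M₃] [TopologicalSpace M₃] [DiscreteTopology M₃] [Finite M₃]
variable {ρ₁ : DiscreteGaloisModule K M₁} {ρ₂ : DiscreteGaloisModule K M₂}
  {ρ₃ : DiscreteGaloisModule K M₃}

omit [TopologicalSpace M₁] [DiscreteTopology M₁] [Finite M₁] [TopologicalSpace M₂] [DiscreteTopology M₂] in
/-- **`μₙ`-valued characters of the image of an injection extend** (finite `n`-torsion target group):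
for `f : M₁ → M₂` injective additive between finite groups with `n·M₂ = 0` and `χ : M₁ →+ μₙ(K̄)` there is
`ψ : M₂ →+ μₙ(K̄)` with `ψ ∘ f = χ` (`restrictHom_surjective` through `μₙ(K̄) ≃ ℤ/n`).
[cite: MilneADT2006, Ch. I, Prop. 0.19] -/
theorem exists_addMonoidHom_mu_comp_eq (f : M₁ →+ M₂) (hf : Injective f) (hM₂ : ∀ m : M₂, n • m = 0)
    (χ : M₁ →+ MuCarrier K n) : ∃ ψ : M₂ →+ MuCarrier K n, ψ.comp f = χ := by
  classical
  let e : MuCarrier K n ≃+ ZMod n := muEquivZMod K n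
  -- transport `χ` to a character of the subgroup `f(M₁)`
  let ι : M₁ ≃+ f.range := AddEquiv.ofBijective (f.rangeRestrict)
    ⟨fun a b h => hf (by simpa using congrArg Subtype.val h), f.rangeRestrict_surjective⟩
  let χ' : f.range →+ ZMod n := (e.toAddMonoidHom.comp χ).comp ι.symm.toAddMonoidHom
  obtain ⟨ψ', hψ'⟩ := restrictHom_surjective hM₂ f.range χ'
  refine ⟨e.symm.toAddMonoidHom.comp ψ', AddMonoidHom.ext fun a => ?_⟩
  have h1 : ψ' (f a) = χ' (ι a) := by
    have := congrArg (fun (h : f.range →+ ZMod n) => h (ι a)) hψ'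
    simp only [restrictHom_apply] at this
    exact this
  have h2 : χ' (ι a) = e (χ a) := by
    change e (χ (ι.symm (ι a))) = e (χ a)
    rw [AddEquiv.symm_apply_apply]
  change e.symm (ψ' (f a)) = χ a
  rw [h1, h2, AddEquiv.symm_apply_apply]

/-- **The Cartier duals of a short exact sequence form a short exact sequence**
`0 → M₃^D →(g^D) M₂^D →(f^D) M₁^D → 0` (`M^D = Hom(M, μₙ)`, maps by precomposition; exactness on the
right: characters of `f(M₁) ≤ M₂` extend, `n·M₂ = 0`). [cite: MilneADT2006, Ch. I §4 (the dual sequence), Prop. 0.19] -/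
theorem isSES_tateDual {f : ρ₁.toContRepresentation →ⁱL ρ₂.toContRepresentation}
    {g : ρ₂.toContRepresentation →ⁱL ρ₃.toContRepresentation}
    (h : IsSES (homOfIntertwining f) (homOfIntertwining g)) (hM₂ : ∀ m : M₂, n • m = 0)
    (gD : (ρ₃.tateDual n).toContRepresentation →ⁱL (ρ₂.tateDual n).toContRepresentation)
    (hgD : ∀ (φ : TateDual K M₃ n) (m : M₂), gD φ m = φ (g m))
    (fD : (ρ₂.tateDual n).toContRepresentation →ⁱL (ρ₁.tateDual n).toContRepresentation)
    (hfD : ∀ (φ : TateDual K M₂ n) (m : M₁), fD φ m = φ (f m)) :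
    IsSES (homOfIntertwining gD) (homOfIntertwining fD) := by
  refine ⟨?_, ?_, ?_, ?_⟩
  · ext φ m : 4
    change fD (gD φ) m = (0 : TateDual K M₁ n) m
    rw [hfD, hgD, DiscreteGaloisModule.TateDual.zero_apply]
    have : g (f m) = 0 := h.g_f_apply m
    rw [this, map_zero]
  · intro φ φ' hφ
    refine DiscreteGaloisModule.TateDual.ext fun m₃ => ?_
    obtain ⟨m, rfl⟩ := h.surjective m₃
    have := congrArg (fun ψ : TateDual K M₂ n => ψ m) hφ
    change gD φ m = gD φ' m at this
    rwa [hgD, hgD] at this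
  · intro ψ hψ
    -- `ψ` kills `f(M₁) = ker g`, so it factors through `g`
    have hker : ∀ m : M₂, g m = 0 → ψ m = 0 := by
      intro m hm
      obtain ⟨a, rfl⟩ := h.exact_mid m hm
      have := congrArg (fun χ : TateDual K M₁ n => χ a) hψ
      change fD ψ a = (0 : TateDual K M₁ n) a at this
      rwa [hfD, DiscreteGaloisModule.TateDual.zero_apply] at this
    classical
    let s : M₃ → M₂ := fun m₃ => (h.surjective m₃).choose
    have hs : ∀ m₃, g (s m₃) = m₃ := fun m₃ => (h.surjective m₃).choose_spec
    let φ : TateDual K M₃ n :=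
      ({ toFun := fun m₃ => ψ (s m₃)
         map_zero' := hker _ (by rw [hs])
         map_add' := fun x y => by
           have e : g (s (x + y) - (s x + s y)) = 0 := by rw [map_sub, map_add, hs, hs, hs, sub_self]
           have := hker _ e
           rw [map_sub, map_add, sub_eq_zero] at this
           exact this } : M₃ →+ MuCarrier K n)
    refine ⟨φ, DiscreteGaloisModule.TateDual.ext fun m => ?_⟩
    change gD φ m = ψ m
    rw [hgD]
    change ψ (s (g m)) = ψ m
    have e : g (s (g m) - m) = 0 := by rw [map_sub, hs, sub_self]
    have := hker _ e
    rwa [map_sub, sub_eq_zero] at this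
  · intro χ
    obtain ⟨ψ, hψ⟩ := exists_addMonoidHom_mu_comp_eq (n := n) (K := K)
      (f.toContinuousLinearMap.toLinearMap.toAddMonoidHom) h.injective hM₂ (χ : M₁ →+ MuCarrier K n)
    refine ⟨(ψ : TateDual K M₂ n), DiscreteGaloisModule.TateDual.ext fun m => ?_⟩
    change fD ψ m = χ m
    rw [hfD]
    exact congrArg (fun h : M₁ →+ MuCarrier K n => h m) hψ

end DualSES

/-! ## §2. At a place: `(ker H¹(f))^⊥ = im H¹(f^D)` -/

section Place

variable {K : Type u} [Field K] [NumberField K] {n : ℕ} [NeZero n]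
variable {M₁ M₂ : Type u}
  [AddCommGroup M₁] [TopologicalSpace M₁] [DiscreteTopology M₁] [Finite M₁]
  [AddCommGroup M₂] [TopologicalSpace M₂] [DiscreteTopology M₂] [Finite M₂]
variable {ρ₁ : DiscreteGaloisModule K M₁} {ρ₂ : DiscreteGaloisModule K M₂}

/-- **`(ker H¹(f))^⊥ ⊆ im H¹(f^D)` at a place `v`.**  For a family `inv` of local invariant maps
perfect at the finite places and injective at the real places, finite `n`-torsion `M₁`, `M₂`, an
intertwining map `f : M₁ → M₂` with a dual `f^D : M₂^D → M₁^D` (`(f^D φ)(m) = φ(f m)`): a local class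
`y ∈ H¹(K_v, M₁^D)` which annihilates `ker (H¹(K_v, M₁) → H¹(K_v, M₂))` under `⟨·,·⟩_v` is
`H¹(f^D) Y` for some `Y ∈ H¹(K_v, M₂^D)`.  Proof: `⟨H¹(f) a, Y⟩ = ⟨a, H¹(f^D) Y⟩`
(`localTatePairingZMod_map_eq`), so the left annihilator of `im H¹(f^D)` is `ker H¹(f)` (left
non-degeneracy of the pairing of `M₂`), and `(ker H¹(f))^⊥ = ({}^⊥ im H¹(f^D))^⊥ = im H¹(f^D)` (double
annihilator in the perfect pairing of `M₁`, Milne I Prop. 0.19).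
[cite: MilneADT2006, Ch. I, Prop. 0.19 and Cor. 2.3] [cite: NeukirchSchmidtWingberg2008, I §4 (1.4.2)] -/
theorem exists_map_tateDual_eq_of_forall_ker (inv : LocalInvariants K n) (hperf : inv.IsPerfect)
    (hreal : inv.InjectiveAtRealPlaces) (hM₁ : ∀ m : M₁, n • m = 0) (hM₂ : ∀ m : M₂, n • m = 0)
    (f : ρ₁.toContRepresentation →ⁱL ρ₂.toContRepresentation)
    (fD : (ρ₂.tateDual n).toContRepresentation →ⁱL (ρ₁.tateDual n).toContRepresentation)
    (hfD : ∀ (φ : TateDual K M₂ n) (m : M₁), fD φ m = φ (f m)) (v : Place K)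
    (y : galoisCohomology ((ρ₁.tateDual n).toLocal v) 1)
    (hy : ∀ a : galoisCohomology (ρ₁.toLocal v) 1,
      galoisCohomology.map (f.restrictField (Place.Completion v)) 1 a = 0 →
        localTatePairingZMod ρ₁ n v (inv v) a y = 0) :
    ∃ Y : galoisCohomology ((ρ₂.tateDual n).toLocal v) 1,
      galoisCohomology.map (fD.restrictField (Place.Completion v)) 1 Y = y := by
  classical
  haveI := finite_galoisCohomology_one_toLocal_place ρ₁ v
  haveI := finite_galoisCohomology_one_tateDual_toLocal_place (n := n) ρ₁ v
  have hA : ∀ x : galoisCohomology (ρ₁.toLocal v) 1, n • x = 0 :=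
    fun x => galoisCohomology.nsmul_eq_zero_of_forall _ hM₁ x
  have hB : ∀ y : galoisCohomology ((ρ₁.tateDual n).toLocal v) 1, n • y = 0 :=
    fun y => galoisCohomology.nsmul_eq_zero_of_forall _
      (fun φ => DiscreteGaloisModule.TateDual.nsmul_eq_zero φ) y
  set b := localTatePairingZMod ρ₁ n v (inv v) with hb
  obtain ⟨hbij, hflip⟩ := bijective_localTatePairingZMod_place inv hperf hreal ρ₁ hM₁ v
  have hinj₂ := (bijective_localTatePairingZMod_place inv hperf hreal ρ₂ hM₂ v).1.1
  set B' : AddSubgroup (galoisCohomology ((ρ₁.tateDual n).toLocal v) 1) :=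
    (galoisCohomology.map (fD.restrictField (Place.Completion v)) 1).range with hB'
  -- `{}^⊥ (im H¹(f^D)) ≤ ker H¹(f)` (left non-degeneracy of the pairing of `M₂` and adjointness)
  have hker : ∀ a ∈ annLeft b B',
      galoisCohomology.map (f.restrictField (Place.Completion v)) 1 a = 0 := by
    intro a ha
    have h0 : localTatePairingZMod ρ₂ n v (inv v)
        (galoisCohomology.map (f.restrictField (Place.Completion v)) 1 a) = 0 :=
      AddMonoidHom.ext fun Y => (localTatePairingZMod_map_eq f fD hfD v (inv v) a Y).trans (ha _ ⟨Y, rfl⟩)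
    exact hinj₂ (h0.trans (map_zero _).symm)
  -- `y ∈ ({}^⊥ im)^⊥ = im` (double annihilator)
  have hy' : y ∈ annRight b (annLeft b B') :=
    (mem_annRight_iff _ _ _).2 fun a ha => hy a (hker a ha)
  rw [annRight_annLeft hA hB b hbij hflip B'] at hy'
  obtain ⟨Y, hY⟩ := hy'
  exact ⟨Y, hY⟩

end Place

end Summit.BirchSwinnertonDyer.BirchSwinnertonDyer.Theorems.KolyvaginRoadThreePT

end
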